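import Mathlib
import Summits.Ventures.PercRepro2.SwOutCrossJunctionBase

/-!
# The base read off a core-kind class point, II: the clusters of the base (blind cell
PercRepro2, night-4 g24, 2026-08-28; proofs/NIGHT4-G24.md §3)

Every vertex of an arm without dropped vertices is red-connected to `h` inside the arm at the
base (`arm_conn_baseX`: the red path of the point — of `blue ζ` on the blue side — is followed
from `h`; its last entry into the arm is an edge from `h`, or an edge from `u` whose partner edge
at `h` has the same colour, and inside the arm the base keeps the colours of that side).  Hence
the red cluster of `h` at the base is the whole structure `structX` (`cluster_baseX_h`), the blue
clusters of `h` and of `u` are `{h}` and `{u}`, the extended hull of the base is the structure,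
which is also the extended hull of the point (`extHull_eq_structX`, `extHull_baseX`), and the
arms read off the base are the arms of the point (`uArmsX_baseX`, `farArmsX_baseX`).
-/

namespace Summit.Ventures.PercRepro2

namespace CrossArm

open Hull LocRows

variable {V : Type*} {E : Type*} [Fintype E] [DecidableEq E]

open scoped Classical

variable {ends : E → Sym2 V} {X : Type*} {U : Set V} {ξ : Config E} {l h o u : V} {p : X → V}
  {G : SimpleGraph X}

section Structure

variable (ends) (h u : V) (p : X → V)

/-- The structure of a configuration: `h`, `u`, the dropped vertices and the arms without
dropped vertices. -/
def structX (ζ : Config E) : Set V :=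
  {v | v = h ∨ v = u ∨ (∃ i, v = p i) ∨ ∃ P ∈ armsC ends h u ζ, (∀ i, p i ∉ P) ∧ v ∈ P}

end Structure

section Conn

variable (hj : CrossJunction ends U h u p G o) (hl : l ∉ U) {ζ : Config E}
  (hζ : ζ ∈ swOutSide ends l h o U ξ) (hk : CoreKind ends U h u ζ)
include hj hl hζ hk

omit hl in
/-- A vertex of the extended hull other than `h`, `u` and the dropped vertices lies in an arm
without dropped vertices. -/
lemma CrossJunction.exists_arm_of_mem_extHull {x : V} (hx : x ∈ extHull ends ζ h u) (hxh : x ≠ h)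
    (hxu : x ≠ u) (hxp : ∀ i, x ≠ p i) :
    ∃ P ∈ armsC ends h u ζ, (∀ i, p i ∉ P) ∧ x ∈ P := by
  obtain ⟨P, hP, hxP⟩ := exists_armsC_of_mem hj.hne_hu hx hxh hxu
  refine ⟨P, hP, fun i hi => ?_, hxP⟩
  obtain ⟨z, -, -, -, rfl⟩ := exists_of_mem_armsC hP
  have : p i ∈ armC ends h u ζ x := by rw [armC_eq_of_mem hxP]; exact hi
  exact hj.p_notMem_armC hζ hk hxp i this

omit hl in
/-- The extended hull of the point is the structure. -/
theorem CrossJunction.extHull_eq_structX : extHull ends ζ h u = structX ends h u p ζ := by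
  ext x
  constructor
  · intro hx
    by_cases hxh : x = h
    · exact Or.inl hxh
    by_cases hxu : x = u
    · exact Or.inr (Or.inl hxu)
    by_cases hxp : ∃ i, x = p i
    · exact Or.inr (Or.inr (Or.inl hxp))
    · exact Or.inr (Or.inr (Or.inr (hj.exists_arm_of_mem_extHull hζ hk hx hxh hxu
        fun i h' => hxp ⟨i, h'⟩)))
  · rintro (rfl | rfl | ⟨i, rfl⟩ | ⟨P, hP, -, hxP⟩)
    · exact Or.inl (Or.inl (mem_cluster_self _ _ _))
    · exact Or.inr (Or.inl (mem_cluster_self _ _ _))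
    · exact BigBlock.p_mem_extHull (hj.hup i) ζ
    · exact (armsC_subset hP x hxP).1

/-- **Every vertex of an arm is red-connected to `h` inside the arm at the base.** -/
theorem CrossJunction.arm_conn_baseX {P : Set V} (hP : P ∈ armsC ends h u ζ)
    (hPp : ∀ i, p i ∉ P) {v : V} (hv : v ∈ P) :
    v ∈ cluster ends (insideConfig ends (P ∪ {h}) (baseX ends h u p ζ)) h := by
  -- the generic argument for a colouring `ω` of the point whose side carries the arm
  have generic : ∀ (ω : Config E), v ∈ cluster ends ω h →
      (∀ x ∈ cluster ends ω h, x ∈ extHull ends ζ h u) →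
      (∀ e x y, x ∈ P → y ∈ P → ends e = s(x, y) → ω e = true → baseX ends h u p ζ e = true) →
      (∀ e e' b, ends e = s(u, b) → ends e' = s(b, h) → ω e = true → ω e' = true) →
      v ∈ cluster ends (insideConfig ends (P ∪ {h}) (baseX ends h u p ζ)) h := by
    intro ω hvω hcl hin hu
    set cl := cluster ends (insideConfig ends (P ∪ {h}) (baseX ends h u p ζ)) h with hcl_def
    have hhP : h ∉ P := fun h' => (armsC_subset hP h h').2.1 rfl
    have key : v ∈ {w | w ∈ cluster ends ω h ∧ (w ∈ P → w ∈ cl)} := by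
      refine mem_of_conn_of_closed (ends := ends) (ω := ω) ?_
        ⟨mem_cluster_self _ _ _, fun h' => absurd h' hhP⟩ hvω
      rintro a ⟨ha, hacl⟩ b hab
      obtain ⟨_, e, he, hends⟩ := openGraph_adj.1 hab
      refine ⟨mem_cluster_of_edge ha he hends, fun hbP => ?_⟩
      by_cases haP : a ∈ P
      · -- an inside edge
        have hσ := hin e a b haP hbP hends he
        have hin' : insideConfig ends (P ∪ {h}) (baseX ends h u p ζ) e = true :=
          insideConfig_eq_true_iff.2 ⟨hσ, a, Or.inl haP, b, Or.inl hbP, hends⟩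
        exact mem_cluster_of_edge (hacl haP) hin' hends
      by_cases hah : a = h
      · have hends' : ends e = s(h, b) := by rw [← hah]; exact hends
        have hσ := hj.baseX_h_edge hl hζ hk hends'
        have hin' : insideConfig ends (P ∪ {h}) (baseX ends h u p ζ) e = true :=
          insideConfig_eq_true_iff.2 ⟨hσ, h, Or.inr rfl, b, Or.inl hbP, hends'⟩
        exact mem_cluster_of_edge (mem_cluster_self _ _ _) hin' hends'
      by_cases hau : a = u
      · have hends' : ends e = s(u, b) := by rw [← hau]; exact hends
        obtain ⟨e', he'⟩ := hj.hu_adj_h e b hends' fun i h' => hPp i (h' ▸ hbP)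
        have hσ := hj.baseX_h_edge hl hζ hk (ends_swap he')
        have hin' : insideConfig ends (P ∪ {h}) (baseX ends h u p ζ) e' = true :=
          insideConfig_eq_true_iff.2 ⟨hσ, h, Or.inr rfl, b, Or.inl hbP, ends_swap he'⟩
        exact mem_cluster_of_edge (mem_cluster_self _ _ _) hin' (ends_swap he')
      · -- `a` is a vertex of the extended hull adjacent to the arm: it lies in the arm
        exfalso
        rcases arm_edge_cases hP (ends_swap hends) hbP with h' | h' | h' | h'
        · exact haP h'
        · exact hah h'
        · exact hau h'
        · exact h' (hcl a ha)
    exact key.2 hv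
  rcases hj.arm_side hl hζ hk hP hPp with hPr | hPb
  · refine generic ζ (hPr hv).1 (fun x hx => Or.inl (Or.inl hx)) ?_ ?_
    · intro e x y hx hy he hω
      rw [hj.baseX_inside_red hζ hk hP hPp hPr he hx hy]; exact hω
    · intro e e' b he he' hω
      rw [← hj.u_edge_eq_h_edge hl hζ hk he he']; exact hω
  · refine generic (blue ζ) (hPb hv).1 (fun x hx => Or.inl (Or.inr hx)) ?_ ?_
    · intro e x y hx hy he hω
      rw [hj.baseX_inside_blue hζ hk hP hPp hPb he hx]; exact hω
    · intro e e' b he he' hω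
      rw [blue_eq_true_iff] at hω ⊢
      rw [← hj.u_edge_eq_h_edge hl hζ hk he he']; exact hω

/-- An arm vertex is in the red cluster of `h` at the base. -/
lemma CrossJunction.arm_mem_cluster_baseX {P : Set V} (hP : P ∈ armsC ends h u ζ)
    (hPp : ∀ i, p i ∉ P) {v : V} (hv : v ∈ P) : v ∈ cluster ends (baseX ends h u p ζ) h :=
  cluster_mono (insideConfig_le _ _) h (hj.arm_conn_baseX hl hζ hk hP hPp hv)

/-- `u` is in the red cluster of `h` at the base. -/
lemma CrossJunction.u_mem_cluster_baseX : u ∈ cluster ends (baseX ends h u p ζ) h := by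
  obtain ⟨P, hP⟩ := hj.exists_uArmsX hζ hk
  obtain ⟨hP', hPp, e, x, hex, hxP⟩ := mem_uArmsX_iff.1 hP
  exact mem_cluster_of_edge (hj.arm_mem_cluster_baseX hl hζ hk hP' hPp hxP)
    (hj.baseX_u_edge hl hζ hk hex) (ends_swap hex)

/-- **The red cluster of `h` at the base is the structure.** -/
theorem CrossJunction.cluster_baseX_h :
    cluster ends (baseX ends h u p ζ) h = structX ends h u p ζ := by
  apply Set.Subset.antisymm
  · intro v hv
    refine mem_of_conn_of_closed (ends := ends) (ω := baseX ends h u p ζ) ?_ (Or.inl rfl) hv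
    rintro a (hah | hau | ⟨i, rfl⟩ | ⟨P, hP, hPp, haP⟩) b hab <;>
      obtain ⟨_, e, he, hends⟩ := openGraph_adj.1 hab
    · -- from `h`
      rw [hah] at hends
      have hbH : b ∈ extHull ends ζ h u := by
        cases hc : ζ e with
        | true => exact Or.inl (Or.inl (mem_cluster_of_edge (mem_cluster_self _ _ _) hc hends))
        | false =>
          have hb : blue ζ e = true := by rw [blue_eq_true_iff]; exact hc
          exact Or.inl (Or.inr (mem_cluster_of_edge (mem_cluster_self _ _ _) hb hends))
      have hbh : b ≠ h := fun h' => hj.hloop_h e (by rw [hends, h'])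
      have hbu : b ≠ u := fun h' => hj.hnadj e (by rw [hends, h'])
      have hbp : ∀ i, b ≠ p i := fun i h' => hj.hnadj_p i e (by rw [hends, h'])
      exact Or.inr (Or.inr (Or.inr (hj.exists_arm_of_mem_extHull hζ hk hbH hbh hbu hbp)))
    · -- from `u`
      rw [hau] at hends
      by_cases hbp : ∃ i, b = p i
      · exact Or.inr (Or.inr (Or.inl hbp))
      · have hbH : b ∈ extHull ends ζ h u := BigBlock.p_mem_extHull ⟨e, hends⟩ ζ
        have hbh : b ≠ h := fun h' => hj.hnadj e (by rw [hends, h', Sym2.eq_swap])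
        have hbu : b ≠ u := fun h' => hj.hloop_u e (by rw [hends, h'])
        exact Or.inr (Or.inr (Or.inr (hj.exists_arm_of_mem_extHull hζ hk hbH hbh hbu
          fun i h' => hbp ⟨i, h'⟩)))
    · -- from a dropped vertex
      rcases hj.p_nbr hends with rfl | ⟨j, rfl, -⟩ | hbU
      · exact Or.inr (Or.inl rfl)
      · exact Or.inr (Or.inr (Or.inl ⟨j, rfl⟩))
      · exfalso
        have hbu : b ≠ u := fun h' => hbU (h' ▸ hj.huU)
        have hbp : ∀ j, b ≠ p j := fun j h' => hbU (h' ▸ hj.hpU j)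
        rw [show baseX ends h u p ζ e = false from crossForce_Ext hj.hne_up hends hbu hbp] at he
        exact Bool.noConfusion he
    · -- from an arm vertex
      rcases arm_edge_cases hP hends haP with h' | h' | h' | h'
      · exact Or.inr (Or.inr (Or.inr ⟨P, hP, hPp, h'⟩))
      · exact Or.inl h'
      · exact Or.inr (Or.inl h')
      · exfalso
        rw [hj.baseX_bdry hl hζ hk hP hPp hends haP h'] at he
        exact Bool.noConfusion he
  · rintro v (rfl | rfl | ⟨i, rfl⟩ | ⟨P, hP, hPp, hvP⟩)
    · exact mem_cluster_self _ _ _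
    · exact hj.u_mem_cluster_baseX hl hζ hk
    · obtain ⟨e, he⟩ := hj.hup i
      exact mem_cluster_of_edge (hj.u_mem_cluster_baseX hl hζ hk) (crossForce_UP he) he
    · exact hj.arm_mem_cluster_baseX hl hζ hk hP hPp hvP

/-- The blue cluster of `h` at the base is `{h}`. -/
theorem CrossJunction.cluster_blue_baseX_h : cluster ends (blue (baseX ends h u p ζ)) h = {h} := by
  apply Set.Subset.antisymm
  · intro v hv
    refine mem_of_conn_of_closed (ends := ends) (ω := blue (baseX ends h u p ζ)) ?_ rfl hv
    rintro a ha b hab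
    obtain ⟨_, e, he, hends⟩ := openGraph_adj.1 hab
    rw [Set.mem_singleton_iff] at ha
    subst ha
    rw [blue_eq_true_iff, hj.baseX_h_edge hl hζ hk hends] at he
    exact Bool.noConfusion he
  · intro v hv
    rw [Set.mem_singleton_iff] at hv
    subst hv
    exact mem_cluster_self _ _ _

/-- The blue cluster of `u` at the base is `{u}`. -/
theorem CrossJunction.cluster_blue_baseX_u : cluster ends (blue (baseX ends h u p ζ)) u = {u} := by
  apply Set.Subset.antisymm
  · intro v hv
    refine mem_of_conn_of_closed (ends := ends) (ω := blue (baseX ends h u p ζ)) ?_ rfl hv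
    rintro a ha b hab
    obtain ⟨_, e, he, hends⟩ := openGraph_adj.1 hab
    rw [Set.mem_singleton_iff] at ha
    subst ha
    rw [blue_eq_true_iff, hj.baseX_u_edge hl hζ hk hends] at he
    exact Bool.noConfusion he
  · intro v hv
    rw [Set.mem_singleton_iff] at hv
    subst hv
    exact mem_cluster_self _ _ _

/-- The red cluster of `u` at the base is the red cluster of `h`. -/
theorem CrossJunction.cluster_baseX_u :
    cluster ends (baseX ends h u p ζ) u = cluster ends (baseX ends h u p ζ) h := by
  have hu := hj.u_mem_cluster_baseX hl hζ hk
  ext x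
  exact ⟨fun hx => conn_trans hu hx, fun hx => conn_trans (conn_symm hu) hx⟩

/-- **The extended hull of the base is the extended hull of the point.** -/
theorem CrossJunction.extHull_baseX :
    extHull ends (baseX ends h u p ζ) h u = extHull ends ζ h u := by
  rw [hj.extHull_eq_structX hζ hk]
  ext x
  simp only [extHull, hull, Set.mem_union]
  rw [hj.cluster_baseX_h hl hζ hk, hj.cluster_blue_baseX_h hl hζ hk, hj.cluster_baseX_u hl hζ hk,
    hj.cluster_baseX_h hl hζ hk, hj.cluster_blue_baseX_u hl hζ hk]
  simp only [Set.mem_singleton_iff]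
  constructor
  · rintro ((hx | rfl) | (hx | rfl))
    · exact hx
    · exact Or.inl rfl
    · exact hx
    · exact Or.inr (Or.inl rfl)
  · intro hx
    exact Or.inl (Or.inl hx)

/-- The u-arms of the base are the u-arms of the point. -/
theorem CrossJunction.uArmsX_baseX :
    uArmsX ends h u p (baseX ends h u p ζ) = uArmsX ends h u p ζ :=
  uArmsX_eq_of_extHull_eq (hj.extHull_baseX hl hζ hk)

/-- The far arms of the base are the far arms of the point. -/
theorem CrossJunction.farArmsX_baseX :
    farArmsX ends h u p (baseX ends h u p ζ) = farArmsX ends h u p ζ :=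
  farArmsX_eq_of_extHull_eq (hj.extHull_baseX hl hζ hk)

end Conn

end CrossArm

end Summit.Ventures.PercRepro2
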